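import Summits.BirchSwinnertonDyer.BirchSwinnertonDyer.Theses.PrintCf2
import Summits.BirchSwinnertonDyer.BirchSwinnertonDyer.Theorems.PrintCf2RamifiedOffTYZJumpOneIsogeny
import Summits.BirchSwinnertonDyer.Rank1Residual.P2.CongruentNumberLevelTwoDoor
import Literature.NumberTheory.EllipticCurves.IsogenyIdProofs
import HarnessLib

/-!
# Item 23431 (`PrintCf2.RamifiedJumpOneLevelTwoOfFacts`, C⁺) IS the `2`-part of BSD on the jump-one class — a by-name
# equivalence certificate (crux stmt-BirchSwinnertonDyer-20509 `RamifiedOffTYZOfFacts`, line `offtyz-v7`, LEAD cruxlead-20509 g19, cycle 20)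

HONEST FRAMING (cell `bsd-print-cf2`, route `PrintCf2`; `--supports stmt-BirchSwinnertonDyer-20509`; fact-free, `def`-free, no `sorry`).
BSD is not proved by any of this; no class is closed by this file; item 23431 and crux 20509 stay OPEN.

The route item stmt-BirchSwinnertonDyer-23431 `RamifiedJumpOneLevelTwoOfFacts` (= stub 7 `stub_offTYZ_levelTwoScriptLExact` of the registered
skeleton v9 of crux 20509, VERBATIM) reads: for every square-free `n ≡ 5, 6, 7 (mod 8)` with `ord_{s=1} L(E_n, s) = 1`,
`#Sel₂(E_n) = 2⁵` and `#Sel₄(E_n) = 2⁶`, every integer `L` with `𝓛(n)² = L²` satisfies `2 ∣ L ∧ 4 ∤ L`.  The planner's docstring says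
"Equivalent to BSD(E_n,2) on that class granted GZK"; the cell typer's door (`P2.bsdp_two_congruentNumberCurve_iff_two_dvd_not_four_dvd`,
p600241/p600425) is that equivalence AT EACH `n` GIVEN an integer `L` with `IsScriptL n L`.  This file records the equivalence AT THE LEVEL OF
THE ITEM, by name, so that the classification of 23431 as «the 2-part of the Birch–Swinnerton-Dyer conjecture for the congruent number
curves `E_n` of analytic rank one with `Ш(E_n)[2^∞] ≅ (ℤ/2)²` — nothing weaker, nothing stronger» is a kernel theorem and not a gloss:

* §1 `bsdpTwoOnJumpOneClass_of_ramifiedJumpOneLevelTwoOfFacts` — granted GZK (`rank_eq_analyticRank_of_analyticRank_le_one`) and TYZ Thm 1.2′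
  (`thm12_parity_of_scriptL'`, integrality of `𝓛(n)`), C⁺ ⟹ `BSD(E_n, 2)` for every member of the class (the door, composed; = the member case
  of skeleton v8's glue, here for the curve `E_n` itself).
* §1 `ramifiedJumpOneLevelTwoOfFacts_of_bsdpTwoOnJumpOneClass` — granted GZK ALONE, `BSD(E_n, 2)` for every member of the class ⟹ C⁺
  (the door is exact: `#Ш(E_n)[2^∞] = 4` on the class, `natCard_primaryComponent_sha_two_eq_four_of_selmerFour`).
* §1 ★ `ramifiedJumpOneLevelTwoOfFacts_iff_bsdpTwoOnJumpOneClass` — granted GZK and TYZ Thm 1.2′ (conjuncts 1 and 5 of the bundle `𝔅_ram` of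
  crux 20509): **item 23431 ⟺ BSD(E_n, 2) on the jump-one class**.
* §2 `ramifiedJumpOneLevelTwoOfFacts_iff_bsdpTwo_isogenyClass` — the same with the class saturated under `ℚ`-isogeny (granted in addition
  modularity `hasEntireLFunction_rat` and Cassels' invariance `bsdRHS_eq_of_isIsogenous`, conjuncts 2 and 3 of `𝔅_ram`; p650357's §1):
  **item 23431 ⟺ BSD(W, 2) for every globally minimal `W/ℚ` of analytic rank one `ℚ`-isogenous to a jump-one `E_n`.**
* §3 `not_ramifiedJumpOneLevelTwoOfFacts_iff` — contrapositive reading for the planner / refuter: granted GZK + Thm 1.2′, C⁺ FAILS iff some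
  jump-one `E_n` of analytic rank one violates `BSD(E_n, 2)` — a refutation of 23431 is a counterexample to the Birch–Swinnerton-Dyer
  conjecture (its `2`-part), and conversely.

Consequence for the line (LEAD notes, cycle 20): the statement of item 23431 is RIGID — every proof of it is a proof of BSD₂ on the class and
every weakening that still closes stub 7 is equivalent to it (granted two printed facts of the bundle); with the literature status of 2026-08
(Burungale–Flach 2024, Camb. J. Math. 12 = the bundle's `bsdTriple_of_hasCM_of_L_one_ne_zero`: all primes, ANALYTIC RANK ZERO; the rank-one
case with `2 ∣ #𝒪_K^×` announced there as future work; Li–Tian–Yan–Zhu 2025, PAMQ 21: `2`-part in rank one for potentially GOOD ORDINARY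
reduction at `2` only) this is an open instance of BSD, not a lemma in print.
-/

noncomputable section

open scoped Classical

open WeierstrassCurve Summit.BirchSwinnertonDyer Summit.BirchSwinnertonDyer.Rank1Residual
  Summit.BirchSwinnertonDyer.BirchSwinnertonDyer.Theses.PrintCf2
  Literature.NumberTheory.EllipticCurves Literature.NumberTheory.EllipticCurves.TianYuanZhang2017

set_option autoImplicit false

namespace Summit.BirchSwinnertonDyer.PrintCf2.LevelTwoDoor

/-! ## §1 Item 23431 ⟺ `BSD(E_n, 2)` on the jump-one class -/

/-- **C⁺ ⟹ BSD₂ on the jump-one class** (granted GZK and TYZ Thm 1.2′): for every square-free `n ≡ 5, 6, 7 (mod 8)` with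
`ord_{s=1} L(E_n, s) = 1`, `#Sel₂(E_n) = 2⁵`, `#Sel₄(E_n) = 2⁶`, the item `RamifiedJumpOneLevelTwoOfFacts` gives `BSD(E_n, 2)` — Thm 1.2′
supplies an integer `L` with `𝓛(n)² = L²`, C⁺ gives `2 ∥ L`, the door concludes.
[cite: TianYuanZhang2017, Thm. 1.2 and §1 (1.1) (arXiv:1411.4728 p0002 L46–L127)] [cite: Miller2011LMS, Def. 1.1] -/
theorem bsdpTwoOnJumpOneClass_of_ramifiedJumpOneLevelTwoOfFacts
    (hGZK : rank_eq_analyticRank_of_analyticRank_le_one) (h12 : thm12_parity_of_scriptL')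
    (hC : RamifiedJumpOneLevelTwoOfFacts) :
    ∀ (n : ℕ) [(congruentNumberCurve n).IsElliptic] [(congruentNumberCurve n).IsGloballyMinimal],
      Squarefree n → (n % 8 = 5 ∨ n % 8 = 6 ∨ n % 8 = 7) → (congruentNumberCurve n).analyticRank = 1 →
      Nat.card ((congruentNumberCurve n).selmerGroup 2) = 2 ^ 5 →
      Nat.card ((congruentNumberCurve n).selmerGroup 4) = 2 ^ 6 → BSDp (congruentNumberCurve n) 2 := by
  intro n _ _ hsq h8 hr hS₂ hS₄
  obtain ⟨L, hL⟩ := P2.exists_isScriptL_of_thm12' h12 hsq h8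
  exact (P2.bsdp_two_congruentNumberCurve_iff_two_dvd_not_four_dvd hGZK hsq hr hL hS₂ hS₄).mpr
    (hC n hsq h8 hr hS₂ hS₄ L hL)

/-- **BSD₂ on the jump-one class ⟹ C⁺** (granted GZK ALONE): if `BSD(E_n, 2)` holds for every square-free `n ≡ 5, 6, 7 (mod 8)` with
`ord_{s=1} L(E_n, s) = 1`, `#Sel₂(E_n) = 2⁵`, `#Sel₄(E_n) = 2⁶`, then every integer `L` with `𝓛(n)² = L²` at such an `n` satisfies `2 ∥ L`
(the door is exact: `#Ш(E_n)[2^∞] = 4` there). [cite: TianYuanZhang2017, §1 (1.1) (arXiv:1411.4728 p0002 L46–L75)] [cite: Miller2011LMS, Def. 1.1] -/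
theorem ramifiedJumpOneLevelTwoOfFacts_of_bsdpTwoOnJumpOneClass
    (hGZK : rank_eq_analyticRank_of_analyticRank_le_one)
    (hB : ∀ (n : ℕ) [(congruentNumberCurve n).IsElliptic] [(congruentNumberCurve n).IsGloballyMinimal],
      Squarefree n → (n % 8 = 5 ∨ n % 8 = 6 ∨ n % 8 = 7) → (congruentNumberCurve n).analyticRank = 1 →
      Nat.card ((congruentNumberCurve n).selmerGroup 2) = 2 ^ 5 →
      Nat.card ((congruentNumberCurve n).selmerGroup 4) = 2 ^ 6 → BSDp (congruentNumberCurve n) 2) :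
    RamifiedJumpOneLevelTwoOfFacts := by
  intro n _ _ hsq h8 hr hS₂ hS₄ L hL
  exact (P2.bsdp_two_congruentNumberCurve_iff_two_dvd_not_four_dvd hGZK hsq hr hL hS₂ hS₄).mp
    (hB n hsq h8 hr hS₂ hS₄)

/-- ★ **Item 23431 ⟺ BSD(E_n, 2) on the jump-one class**, granted GZK (`rank_eq_analyticRank_of_analyticRank_le_one`) and TYZ Thm 1.2′
(`thm12_parity_of_scriptL'`) — conjuncts 1 and 5 of the bundle `𝔅_ram` of crux 20509.  The route item `RamifiedJumpOneLevelTwoOfFacts` is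
therefore exactly the `2`-part of the Birch–Swinnerton-Dyer conjecture for the congruent number curves `E_n : y² = x³ − n²x`, `n` square-free,
`n ≡ 5, 6, 7 (mod 8)`, of analytic rank one with `#Sel₂(E_n) = 2⁵` and `#Sel₄(E_n) = 2⁶` (i.e. `Ш(E_n)[2^∞] ≅ (ℤ/2)²`).
[cite: TianYuanZhang2017, Thm. 1.2 and §1 (1.1) (arXiv:1411.4728 p0002 L46–L127)] [cite: Miller2011LMS, Def. 1.1] -/
theorem ramifiedJumpOneLevelTwoOfFacts_iff_bsdpTwoOnJumpOneClass
    (hGZK : rank_eq_analyticRank_of_analyticRank_le_one) (h12 : thm12_parity_of_scriptL') :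
    RamifiedJumpOneLevelTwoOfFacts ↔
      ∀ (n : ℕ) [(congruentNumberCurve n).IsElliptic] [(congruentNumberCurve n).IsGloballyMinimal],
        Squarefree n → (n % 8 = 5 ∨ n % 8 = 6 ∨ n % 8 = 7) → (congruentNumberCurve n).analyticRank = 1 →
        Nat.card ((congruentNumberCurve n).selmerGroup 2) = 2 ^ 5 →
        Nat.card ((congruentNumberCurve n).selmerGroup 4) = 2 ^ 6 → BSDp (congruentNumberCurve n) 2 :=
  ⟨fun hC n _ _ => bsdpTwoOnJumpOneClass_of_ramifiedJumpOneLevelTwoOfFacts hGZK h12 hC n,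
    ramifiedJumpOneLevelTwoOfFacts_of_bsdpTwoOnJumpOneClass hGZK⟩

/-! ## §2 The same with the class saturated under `ℚ`-isogeny -/

/-- ★ **Item 23431 ⟺ BSD(W, 2) for every globally minimal `W/ℚ` of analytic rank one that is `ℚ`-isogenous to a jump-one `E_n`**
(`n` square-free, `n ≡ 5, 6, 7 (mod 8)`, `#Sel₂(E_n) = 2⁵`, `#Sel₄(E_n) = 2⁶`), granted GZK, TYZ Thm 1.2′, modularity
(`hasEntireLFunction_rat`) and Cassels' isogeny invariance of the BSD quotient (`bsdRHS_eq_of_isIsogenous`) — conjuncts 1, 5, 2, 3 of `𝔅_ram`.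
(⟹ is p650357's `bsdp_two_of_isIsogenous_jumpOne_of_levelTwoScriptLExact`; ⟸ specialises to `W = E_n`, isogenous to itself.)
[cite: MilneADT2006, Thm. I.7.3] [cite: TianYuanZhang2017, Thm. 1.2 and §1 (1.1)] [cite: Miller2011LMS, Def. 1.1] -/
theorem ramifiedJumpOneLevelTwoOfFacts_iff_bsdpTwo_isogenyClass
    (hGZK : rank_eq_analyticRank_of_analyticRank_le_one) (h12 : thm12_parity_of_scriptL')
    (hL : hasEntireLFunction_rat) (hCassels : bsdRHS_eq_of_isIsogenous) :
    RamifiedJumpOneLevelTwoOfFacts ↔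
      ∀ (W : WeierstrassCurve ℚ) [W.IsElliptic] [W.IsGloballyMinimal], W.analyticRank = 1 →
        (∃ n : ℕ, Squarefree n ∧ (n % 8 = 5 ∨ n % 8 = 6 ∨ n % 8 = 7) ∧
            Nat.card ((congruentNumberCurve n).selmerGroup 2) = 2 ^ 5 ∧
            Nat.card ((congruentNumberCurve n).selmerGroup 4) = 2 ^ 6 ∧ IsIsogenous W (congruentNumberCurve n)) →
        BSDp W 2 := by
  constructor
  · intro hC W _ _ hrW hJ
    obtain ⟨n, hsq, h8, hS₂, hS₄, hiso⟩ := hJ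
    exact bsdp_two_of_isIsogenous_jumpOne_of_levelTwoScriptLExact h12 hGZK hL hCassels
      (fun n _ _ hsq h8 hr hS₂ hS₄ L hL' => hC n hsq h8 hr hS₂ hS₄ L hL') hrW hsq h8 hS₂ hS₄ hiso
  · intro hB
    refine ramifiedJumpOneLevelTwoOfFacts_of_bsdpTwoOnJumpOneClass hGZK ?_
    intro n _ _ hsq h8 hr hS₂ hS₄
    exact hB (congruentNumberCurve n) hr ⟨n, hsq, h8, hS₂, hS₄, isIsogenous_self (congruentNumberCurve n)⟩

/-! ## §3 Contrapositive reading: a refutation of 23431 is a counterexample to BSD₂, and conversely -/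

/-- Granted GZK and TYZ Thm 1.2′: **C⁺ fails iff some jump-one congruent number curve of analytic rank one violates the `2`-part of BSD.**
[cite: TianYuanZhang2017, Thm. 1.2 and §1 (1.1)] [cite: Miller2011LMS, Def. 1.1] -/
theorem not_ramifiedJumpOneLevelTwoOfFacts_iff
    (hGZK : rank_eq_analyticRank_of_analyticRank_le_one) (h12 : thm12_parity_of_scriptL') :
    ¬ RamifiedJumpOneLevelTwoOfFacts ↔
      ∃ (n : ℕ) (_ : (congruentNumberCurve n).IsElliptic) (_ : (congruentNumberCurve n).IsGloballyMinimal),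
        Squarefree n ∧ (n % 8 = 5 ∨ n % 8 = 6 ∨ n % 8 = 7) ∧ (congruentNumberCurve n).analyticRank = 1 ∧
        Nat.card ((congruentNumberCurve n).selmerGroup 2) = 2 ^ 5 ∧
        Nat.card ((congruentNumberCurve n).selmerGroup 4) = 2 ^ 6 ∧ ¬ BSDp (congruentNumberCurve n) 2 := by
  rw [ramifiedJumpOneLevelTwoOfFacts_iff_bsdpTwoOnJumpOneClass hGZK h12]
  constructor
  · intro h
    by_contra hne
    apply h
    intro n _ _ hsq h8 hr hS₂ hS₄
    by_contra hb
    exact hne ⟨n, ‹_›, ‹_›, hsq, h8, hr, hS₂, hS₄, hb⟩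
  · rintro ⟨n, _, _, hsq, h8, hr, hS₂, hS₄, hb⟩ h
    exact hb (h n hsq h8 hr hS₂ hS₄)

end Summit.BirchSwinnertonDyer.PrintCf2.LevelTwoDoor

end
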